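import Summits.Ventures.Crystal3D.Theorems.StickyWulffConstantNoReconstructionGainOffRegistry
import Summits.Ventures.Crystal3D.Theorems.StickyWulffConstantNoReconstructionGainOffLattice
import Summits.Ventures.Crystal3D.Theorems.StickyWulffConstantNoReconstructionGainPeeling
import HarnessLib

/-!
# A rung of the atom for every normal: films whose off-lattice part is contact-3-degenerate

HONEST FRAMING. Part of the venture `Summits/Ventures/Crystal3D` (cell `crystal3d-full`), helper
`--supports` the crux `NoReconstructionGain` (stmt-Ventures-19144, route
`route-Ventures-StickyWulffConstant`), line `adhesion`.  The R26 certificate chain of this lineage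
(`…Certificate` p516312, `…Peeling` p518005, `…OffLattice` p520278, `…Registry` p521361,
`…OffRegistry` p522036) composed into an UNCONDITIONAL rung of the registered atom
`stub_adhesion`, valid for EVERY normal `ν` and with NO rim defect (`C = 0`):

`offRegistryThreeDegenerate_adhesion` — let `X ⊇ P` be a finite unit packing around the `ν`-slab
sample `P`, and suppose the OFF-LATTICE film balls `O = {x ∈ X \ P : x ∉ Λ₀}` form a
contact-3-degenerate set (every nonempty `S ⊆ O` has a ball with at most three partners in `S`:
isolated adatoms in arbitrary positions, ad-dimers, chains, trees, sparse nets, …; the registry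
part of the film is arbitrary).  Then `#cross(P, X \ P) ≤ contactDeficiency (X \ P)`.

Proof: a ball of `S ⊆ O` with `≤ 3` partners in `S` has `≤ 3` partners in the enlarged lattice plug
`X \ O` (`fcc_offLattice_unitContacts_le_three`), so `O` is plug-relatively 6-degenerate; peel
(`exists_potential_of_sixDegenerate`), stack under the registry balls
(`exists_potential_of_offRegistry`), telescope (`cross_le_of_potential`, `E = ∅`).

WHAT THIS IS NOT: the atom for dense off-lattice overlayers (other grains, amorphous films —
not 3-degenerate); rung F-C1 not moved.
-/

noncomputable section

namespace Summit.Ventures.Crystal3D.Theorems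

open Summit.Ventures.Crystal3D Finset
open Literature.MathematicalPhysics.StatisticalMechanics (fccStacking orderedContacts contactDeficiency)
open scoped InnerProductSpace

/-- **The atom for films with contact-3-degenerate off-lattice part** (all normals, `R = 1`,
`C = 0`; registered by name on stmt-Ventures-19144). -/
theorem offRegistryThreeDegenerate_adhesion :
    ∃ R C : ℝ, 1 ≤ R ∧ ∀ ν : EuclideanSpace ℝ (Fin 3), ‖ν‖ = 1 → ∀ ρ : ℝ, R ≤ ρ →
      ∀ X P : Finset (EuclideanSpace ℝ (Fin 3)),
      (∀ p ∈ X, ∀ q ∈ X, p ≠ q → 1 ≤ dist p q) → P ⊆ X →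
      (∀ p, p ∈ P ↔ (p ∈ fccStacking 1 (Real.sqrt (2 / 3)) ∧ -(2 * R) ≤ ⟪p, ν⟫_ℝ ∧
        ⟪p, ν⟫_ℝ ≤ -R ∧ ‖p‖ ^ 2 - ⟪p, ν⟫_ℝ ^ 2 ≤ ρ ^ 2)) →
      (∀ S ⊆ X \ P, (∀ x ∈ S, x ∉ fccStacking 1 (Real.sqrt (2 / 3))) → S.Nonempty →
        ∃ q ∈ S, (S.filter fun x => dist q x = 1).card ≤ 3) →
      ((((P ×ˢ (X \ P)).filter fun pq => dist pq.1 pq.2 = 1).card : ℕ) : ℝ) ≤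
        contactDeficiency (X \ P) + C * ρ := by
  classical
  refine ⟨1, 0, le_rfl, fun ν hν ρ hρ X P hX hPX hP hdeg => ?_⟩
  -- the off-lattice part of the film
  set O := (X \ P).filter fun x => x ∉ fccStacking 1 (Real.sqrt (2 / 3)) with hOdef
  have hO : O ⊆ X \ P := filter_subset _ _
  have hOX : O ⊆ X := hO.trans sdiff_subset
  have hXO : X \ (X \ O) = O := Finset.sdiff_sdiff_eq_self hOX
  have hreg : ∀ x ∈ (X \ P) \ O, x ∈ fccStacking 1 (Real.sqrt (2 / 3)) := by
    intro x hx
    rw [mem_sdiff, hOdef, mem_filter] at hx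
    by_contra hxΛ
    exact hx.2 ⟨hx.1, hxΛ⟩
  have hoff : ∀ x ∈ O, x ∉ fccStacking 1 (Real.sqrt (2 / 3)) := fun x hx => (mem_filter.1 hx).2
  have hplugΛ : ∀ y ∈ X \ O, y ∈ fccStacking 1 (Real.sqrt (2 / 3)) := by
    intro y hy
    by_cases hyP : y ∈ P
    · exact ((hP y).1 hyP).1
    · exact hreg y (mem_sdiff.2 ⟨mem_sdiff.2 ⟨(mem_sdiff.1 hy).1, hyP⟩, (mem_sdiff.1 hy).2⟩)
  -- `O` is 6-degenerate relative to the enlarged plug `X \ O`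
  have hsix : ∀ S ⊆ X \ (X \ O), S.Nonempty →
      ∃ q ∈ S, (((X \ O) ∪ S).filter fun x => dist q x = 1).card ≤ 6 := by
    intro S hS hSne
    rw [hXO] at hS
    obtain ⟨q, hqS, hq3⟩ := hdeg S (hS.trans hO) (fun x hx => hoff x (hS hx)) hSne
    refine ⟨q, hqS, ?_⟩
    have hplug3 : ((X \ O).filter fun x => dist q x = 1).card ≤ 3 :=
      fcc_offLattice_unitContacts_le_three q (hoff q (hS hqS)) _
        (fun y hy => ⟨hplugΛ y (mem_filter.1 hy).1, (mem_filter.1 hy).2⟩)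
    calc (((X \ O) ∪ S).filter fun x => dist q x = 1).card
        ≤ ((X \ O).filter fun x => dist q x = 1).card + (S.filter fun x => dist q x = 1).card := by
          rw [filter_union]; exact card_union_le _ _
      _ ≤ 6 := by omega
  obtain ⟨Ψ, hΨ⟩ := exists_potential_of_sixDegenerate X (X \ O) (X \ (X \ O)) sdiff_subset
    subset_rfl hsix
  -- stack under the registry balls (no exemptions)
  have hΨ' : ∀ q ∈ O \ (∅ : Finset (EuclideanSpace ℝ (Fin 3))),
      (((X \ (X \ O)).filter fun x => dist q x = 1 ∧ Ψ x < Ψ q).card : ℤ)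
          + (((X \ O).filter fun p => dist q p = 1).card : ℤ)
        ≤ (12 - ((X.filter fun x => dist q x = 1).card : ℤ))
          + (((X \ (X \ O)).filter fun x => dist q x = 1 ∧ Ψ q < Ψ x).card : ℤ) := by
    intro q hq
    rw [sdiff_empty] at hq
    exact hΨ q (by rw [hXO]; exact hq)
  obtain ⟨Φ, hΦ⟩ := exists_potential_of_offRegistry ν hν 1 ρ one_pos (by linarith) X P O ∅ hPX hP
    hO hreg Ψ hΨ'
  -- telescope with the empty rim set
  have h := cross_le_of_potential X P ∅ hX hPX (empty_subset _) Φ hΦ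
  simpa using h

/-- **The atom from plug-relative 6-degeneracy of the off-lattice part** (all normals,
`R = 1`, `C = 0`; the most general unconditional output of the R26 chain; registered by name).
If every nonempty set `S` of off-lattice film balls contains a ball `q` with
`#{partners of q in S} + #L ≤ 6` for every set `L ⊆ X` of lattice-site partners of `q`
(decidability-free phrasing of «+ #{lattice-site partners}»), then
`#cross(P, X \ P) ≤ contactDeficiency (X \ P)`. -/
theorem offRegistrySixDegenerate_adhesion :
    ∃ R C : ℝ, 1 ≤ R ∧ ∀ ν : EuclideanSpace ℝ (Fin 3), ‖ν‖ = 1 → ∀ ρ : ℝ, R ≤ ρ →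
      ∀ X P : Finset (EuclideanSpace ℝ (Fin 3)),
      (∀ p ∈ X, ∀ q ∈ X, p ≠ q → 1 ≤ dist p q) → P ⊆ X →
      (∀ p, p ∈ P ↔ (p ∈ fccStacking 1 (Real.sqrt (2 / 3)) ∧ -(2 * R) ≤ ⟪p, ν⟫_ℝ ∧
        ⟪p, ν⟫_ℝ ≤ -R ∧ ‖p‖ ^ 2 - ⟪p, ν⟫_ℝ ^ 2 ≤ ρ ^ 2)) →
      (∀ S ⊆ X \ P, (∀ x ∈ S, x ∉ fccStacking 1 (Real.sqrt (2 / 3))) → S.Nonempty →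
        ∃ q ∈ S, ∀ L ⊆ X, (∀ y ∈ L, y ∈ fccStacking 1 (Real.sqrt (2 / 3)) ∧ dist q y = 1) →
          (S.filter fun x => dist q x = 1).card + L.card ≤ 6) →
      ((((P ×ˢ (X \ P)).filter fun pq => dist pq.1 pq.2 = 1).card : ℕ) : ℝ) ≤
        contactDeficiency (X \ P) + C * ρ := by
  classical
  refine ⟨1, 0, le_rfl, fun ν hν ρ hρ X P hX hPX hP hdeg => ?_⟩
  set O := (X \ P).filter fun x => x ∉ fccStacking 1 (Real.sqrt (2 / 3)) with hOdef
  have hO : O ⊆ X \ P := filter_subset _ _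
  have hOX : O ⊆ X := hO.trans sdiff_subset
  have hXO : X \ (X \ O) = O := Finset.sdiff_sdiff_eq_self hOX
  have hreg : ∀ x ∈ (X \ P) \ O, x ∈ fccStacking 1 (Real.sqrt (2 / 3)) := by
    intro x hx
    rw [mem_sdiff, hOdef, mem_filter] at hx
    by_contra hxΛ
    exact hx.2 ⟨hx.1, hxΛ⟩
  have hoff : ∀ x ∈ O, x ∉ fccStacking 1 (Real.sqrt (2 / 3)) := fun x hx => (mem_filter.1 hx).2
  -- the enlarged plug consists of lattice sites
  have hplugΛ : ∀ y ∈ X \ O, y ∈ fccStacking 1 (Real.sqrt (2 / 3)) := by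
    intro y hy
    by_cases hyP : y ∈ P
    · exact ((hP y).1 hyP).1
    · exact hreg y (mem_sdiff.2 ⟨mem_sdiff.2 ⟨(mem_sdiff.1 hy).1, hyP⟩, (mem_sdiff.1 hy).2⟩)
  have hsix : ∀ S ⊆ X \ (X \ O), S.Nonempty →
      ∃ q ∈ S, (((X \ O) ∪ S).filter fun x => dist q x = 1).card ≤ 6 := by
    intro S hS hSne
    rw [hXO] at hS
    obtain ⟨q, hqS, hq6⟩ := hdeg S (hS.trans hO) (fun x hx => hoff x (hS hx)) hSne
    refine ⟨q, hqS, le_trans ?_ (hq6 ((X \ O).filter fun x => dist q x = 1)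
      ((filter_subset _ _).trans sdiff_subset)
      (fun y hy => ⟨hplugΛ y (mem_filter.1 hy).1, (mem_filter.1 hy).2⟩))⟩
    rw [filter_union, add_comm]
    exact card_union_le _ _
  obtain ⟨Ψ, hΨ⟩ := exists_potential_of_sixDegenerate X (X \ O) (X \ (X \ O)) sdiff_subset
    subset_rfl hsix
  have hΨ' : ∀ q ∈ O \ (∅ : Finset (EuclideanSpace ℝ (Fin 3))),
      (((X \ (X \ O)).filter fun x => dist q x = 1 ∧ Ψ x < Ψ q).card : ℤ)
          + (((X \ O).filter fun p => dist q p = 1).card : ℤ)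
        ≤ (12 - ((X.filter fun x => dist q x = 1).card : ℤ))
          + (((X \ (X \ O)).filter fun x => dist q x = 1 ∧ Ψ q < Ψ x).card : ℤ) := by
    intro q hq
    rw [sdiff_empty] at hq
    exact hΨ q (by rw [hXO]; exact hq)
  obtain ⟨Φ, hΦ⟩ := exists_potential_of_offRegistry ν hν 1 ρ one_pos (by linarith) X P O ∅ hPX hP
    hO hreg Ψ hΨ'
  have h := cross_le_of_potential X P ∅ hX hPX (empty_subset _) Φ hΦ
  simpa using h

end Summit.Ventures.Crystal3D.Theorems
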